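/-
Origin: expansion seat `planner-pub-hodgecm-mc-axioms-1-g14-0`, handover #W187 2026-08-20T15:53:55Z md5 80ccd018beb2 (PKG e4cf23fda8fb → 80ccd018beb2; 192 l.; MECHANICAL (iib-R) rewrite v3.1 of the PKG file as it stands (48 token edits; rules R1x2+RX[h₂']x46)) (`HOME/mc/pub-hodgecm-mc-axioms-1-g14/revendor/kit-r55/stage55/HodgeCM/Model/Sanity/DegenerateClosureR18A.lean`, md5 80ccd018beb2, 192 lines);
landed by the gen-22 packager (p-g22) in gate run 55 REPLACES the earlier landed copy of `HodgeCM/Model/Sanity/DegenerateClosureR18A.lean` (seat copy carried the packager Origin header of an earlier run (stripped)).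
-/
/-
Origin: SANITY lane `planner-pub-hodgecm-mc-sanity-1-g10-0` (unit pub-hodgecm-mc-sanity-1-g10, gen 10 of mc-sanity-1,
node SAN-20), 2026-08-20.  NEW additive KERNEL leaf `HodgeCM/Model/Sanity/DegenerateClosureR18A.lean` over the
RUN-37 modules `HodgeCM.Model.E2InstanceR18A` / `HodgeCM.Model.E2InstanceR18AE` (glue-1-g7 #360 / #361: E revisions
18A / 18AE = R15A / R15AE with row 9 `hLiu` ↦ `hsmall` via mc-axioms-1 `Model.hLiu_of_smallLevel`), the RUN-36 census
leaf `HodgeCM.Model.Sanity.DegenerateClosureR17A` (SAN-17 rev. 2; brings SAN-15 `CdegS` / `NoGoodSextic`, SAN-10b,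
SAN-11, SAN-12, SAN-17a) and `HodgeCM.Model.ToyG2.LevelExists` (`Level.nonempty`, the (W1) pair `Level.three`).
Imported by nothing.  INSTALL AFTER all four.
KERNEL: 0 records, 0 `Prop` definitions, 0 hypotheses minted, nothing cited, no instances.
Expected `#print axioms`: ⊆ {propext, Classical.choice, Quot.sound}.
-/
import Summits.HodgeConjecture.HodgeCM.Model.E2InstanceR18A
import Summits.HodgeConjecture.HodgeCM.Model.E2InstanceR18AE
import Summits.HodgeConjecture.HodgeCM.Model.Sanity.DegenerateClosureR17A
import Summits.HodgeConjecture.HodgeCM.Model.ToyG2.LevelExists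

/-!
# SAN-20 — the DEGENERATE CLOSURE of E R18A / R18AE (row 9 `hLiu` ↦ `hsmall`, the print-shaped level-smallness binder)

MODEL-CONSTRUCTION sub-cell, SANITY lane (unit `pub-hodgecm-mc-sanity-1-g10`, node SAN-20).  KERNEL only; census leaf.

SAN-17 (`Sanity/DegenerateClosureR17A`) closed E R15A″ / R17A″ over the degenerate inhabitants `S := degS`,
`W := zeroSK ∘ W` modulo the single DATA binder `CdegS` (empty: SAN-15b `isEmpty_CdegS_of_goodSextic` /
`nonempty_CdegS_iff_noGoodSextic`).  Revision 18A (RUN 37; BINDER-TRIAGE §58 (L-small-P), §60 (Θ-sat-≤)) replaces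
row 9 `hLiu` («Liu isotypy at EVERY level `Γ`») by `hsmall` («… at every level `Γ ≤ Γ₀` for SOME `Γ₀`», in the
`K`-order of the (W1) `Level` pair), and 18AE is the same corollary of the E TERM OF RECORD `Model.perL_picardCM_r15AE`
((iii)♭ universe parameter `CMAbelianVarietyEigenbasisRealised`).  This file records what the trade costs over the
degenerate data:

* `hsmall_degS` — over `degS` the binder `hsmall` is FREE in every good context: `hsmall` is implied by `hLiu`
  (take any `Γ₀`, e.g. the one `Level.nonempty` provides, and restrict), and `hLiu` is free over `degS` (SAN-11
  `hLiu_degS`: the theta sets of E's model over `degS` collapse, `theta_thetaModelOf_degS_eq`).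
* `perL_r18A_degS` — E R18A at `S := degS`, `W := zeroSK ∘ W` closes `(picardCMUniverse …).PerL` from
  `hHR h hA W μ hBetti hR` and the ONE binder `CdegS`; `hT` by SAN-17a `isThetaArchContinuous_degS`, `hpd` / `hk` by
  `isEmptyElim` on the empty fibre of `C` over `degS` (SAN-10b `isEmpty_C_fibre_degS`), `gen12` / `real34` / `hyp12` /
  `hyp34` by the SAN-12 kernel theorems — every discharge VERBATIM as in SAN-17 `perL_r15Acore_degS`.
* `perL_r18AE_degS` — the same for E R18AE, i.e. at the universe parameter `h₃ := cmAbelianVarietyRealised_of_eigenbasis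
  hHD hI h₃'` of the E term of record's lineage.
* `perL_r18A_of_noGoodSextic` — so R18A, like R10 / R13 / R15A / R17A, closes from toys EXACTLY modulo the vacuity
  residual `NoGoodSextic` (refuted in kernel by prl1-g15's good sextic witness: SAN-15b `not_noGoodSextic`).

READING (census, MODEL-N ±0; nothing here is a defect claim): the R15A → R18A trade moves row 9 towards print
([Liu21]'s neat-`K` statement; «E assumes LESS») without changing the degenerate census — over degenerate data every
binder of E R18A / R18AE except `C` is free and `C` is the gatekeeper; `hsmall`, being weaker than `hLiu`, carries no
content that the toys could fake past `C`.
-/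

set_option autoImplicit false

noncomputable section

namespace HodgeCM
namespace Model
namespace Sanity

open HodgeCM.Universe (SideData ThetaModel AdelicThetaCore AdelicTorusCore)
open HodgeCM.PerL34 HodgeCM.PerL34.ArchC
open Literature.AlgebraicGeometry.HodgeTheory Literature.NumberTheory.Automorphic.PicardCM
open Literature.NumberTheory.Transcendental (Arapura2012_Cor_15_4_6)
open Literature.AlgebraicGeometry.ShimuraVarieties
open HodgeCM.Model.ThetaSpace
open HodgeCM.Model.SupplyResidual

section HSmall

variable (hHD : exists_isReal_hodgeModel) (hI : hodgePQ_independent_of_hodgeModel)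
  (h₁ : BallQuotientUniformised)  (h₃ : CMAbelianVarietyRealised)

/-- **R18A's row 9 `hsmall` over `degS`: free in a good context** (any model parameters `h emb cover wm d12 d34`,
as in SAN-11) — any level `Γ₀` (one exists: `Level.nonempty`, the (W1) pair `Level.three V`) works, because `hLiu`
is free over `degS` at EVERY level (SAN-11 `hLiu_degS`); the degree hypothesis is not even used. -/
theorem hsmall_degS (h : Bool) (emb) (cover) (wm) (d12 d34 : ∀ {L : CMField}, SeesawCtx L → SideData L)
    {L : CMField} {ι₁ : L →+* ℂ} (V : HermSpace3 L ι₁) (c : SeesawCtx L)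
    (hc : (thetaModelOf hHD hI h₁ h₃ h emb cover wm
      (thetaOf _ (thetaClassInputOf _ (fun V c => thetaSpaceInputOf hHD hI h₁ h₃ degS V c))) d12 d34).GoodCtx ι₁ c)
    (hK : Module.finrank ℚ c.K = 6) (i : Fin 4) :
    ∃ Γ₀ : Level V, ∀ Γ ≤ Γ₀,
      ∃ (M : CMField) (k : c.K →+* M) (σ' : M →+* ℂ), σ'.comp k = c.σ ∧
        (thetaModelOf hHD hI h₁ h₃ h emb cover wm
          (thetaOf _ (thetaClassInputOf _ (fun V c => thetaSpaceInputOf hHD hI h₁ h₃ degS V c))) d12 d34).Theta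
            V c i Γ ⊆ (picardCMUniverse hHD hI h₁ h₃).Uiso Γ M (HodgeCM.CMTypeOps.inflate k (c.Ψ i)) σ' := by
  obtain ⟨Γ₀⟩ := Level.nonempty V
  exact ⟨Γ₀, fun Γ _ => hLiu_degS hHD hI h₁ h₃ h emb cover wm d12 d34 V c hc hK i Γ⟩

end HSmall

variable (hHD : exists_isReal_hodgeModel) (hI : hodgePQ_independent_of_hodgeModel)
  (h₁ : BallQuotientUniformised)

/-- **E R18A over the degenerate data closes PerL modulo the single binder `C`** — `hsmall` by `hsmall_degS`,
everything else VERBATIM as in SAN-17 `perL_r15Acore_degS` (`hT` SAN-17a, `hpd` / `hk` SAN-10b, `gen12` / `real34` /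
`hyp12` / `hyp34` SAN-12). -/
theorem perL_r18A_degS (h₃ : CMAbelianVarietyRealised) (hHR : BettiUniverse.HodgeRiemann20) (h : Bool)
    (hA : Arapura2012_Cor_15_4_6)
    (W : ∀ {L : CMField} {ι₁ : L →+* ℂ} (V : HermSpace3 L ι₁) (c : SeesawCtx L), WmInput V c.D)
    (μ : ∀ {L : CMField}, SeesawCtx L → Fin 4 → NumberField.InfinitePlace L → ℤ)
    (hBetti : ∀ {L : CMField} {ι₁ : L →+* ℂ} (V : HermSpace3 L ι₁), EmbBettiSide hHD hI h₁ h₃ V)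
    (hR : DeligneMilne1982_Thm_6_20_full)
    (C : CdegS hHD hI h₁ h₃ h hA W μ) :
    (picardCMUniverse hHD hI h₁ h₃).PerL := by
  refine perL_picardCM_r18A hHD hI h₁ h₃ hHR h hA (fun V c => (W V c).zeroSK) degS μ hBetti hR
    ?_ C ?_ ?_ ?_ ?_ ?_ ?_ ?_
  · -- `hsmall` — `hsmall_degS` (SAN-11 `hLiu_degS` at any level below `Level.nonempty`'s witness)
    intro L ι₁ V c hc hK i
    exact hsmall_degS hHD hI h₁ h₃ h (embOf hHD hI h₁ h₃) (coverOf hHD hI h₁ h₃ hA)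
      (wmOfInput fun V c => (W V c).zeroSK) (d12Of μ) (d34Of μ) V c hc hK i
  · -- `hT` — free over `degS` (SAN-17a)
    intro L ι₁ V c k N
    exact isThetaArchContinuous_degS V c k N
  · -- `hpd` — the fibre of `C` over `degS` is empty (SAN-10b)
    intro L ι₁ V c hV hc h6 k hk N hN
    exact ((isEmpty_C_fibre_degS hHD hI h₁ h₃ V c hV).false (C V c hV hc h6)).elim
  · -- `hk` — idem
    intro L ι₁ V c hV hc h6 k hk N hN
    exact ((isEmpty_C_fibre_degS hHD hI h₁ h₃ V c hV).false (C V c hV hc h6)).elim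
  · -- `gen12` — SAN-12 `gen12_degS'`
    intro L ι₁ V c
    exact gen12_degS' hHD hI h₁ h₃ h (embOf hHD hI h₁ h₃) (coverOf hHD hI h₁ h₃ hA)
      (fun V c => (W V c).zeroSK) μ V c
  · -- `real34` — SAN-12 `real34_zeroSK`
    intro L ι₁ V c _ _
    exact real34_zeroSK (embOf hHD hI h₁ h₃) (coverOf hHD hI h₁ h₃ hA) W _ h (d12Of μ) (d34Of μ) V c
  · -- `hyp12` — SAN-12 `hyp12_zeroSK`
    intro L ι₁ V c _ _
    exact hyp12_zeroSK (embOf hHD hI h₁ h₃) (coverOf hHD hI h₁ h₃ hA) W _ h _ _ _ V c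
  · -- `hyp34` — SAN-12 `hyp34_zeroSK`
    intro L ι₁ V c _ _
    exact hyp34_zeroSK (embOf hHD hI h₁ h₃) (coverOf hHD hI h₁ h₃ hA) W _ h _ _ _ V c

/-- **E R18AE (the (L-lvl) corollary of the E TERM OF RECORD `Model.perL_picardCM_r15AE`) over the degenerate data
closes PerL modulo the single binder `C`** — `perL_picardCM_r18AE` itself at `S := degS`, `W := zeroSK ∘ W`, i.e.
`perL_r18A_degS`'s discharges at the universe parameter `cmAbelianVarietyRealised_of_eigenbasis hHD hI h₃'`. -/
theorem perL_r18AE_degS (h₃' : CMAbelianVarietyEigenbasisRealised) (hHR : BettiUniverse.HodgeRiemann20) (h : Bool)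
    (hA : Arapura2012_Cor_15_4_6)
    (W : ∀ {L : CMField} {ι₁ : L →+* ℂ} (V : HermSpace3 L ι₁) (c : SeesawCtx L), WmInput V c.D)
    (μ : ∀ {L : CMField}, SeesawCtx L → Fin 4 → NumberField.InfinitePlace L → ℤ)
    (hBetti : ∀ {L : CMField} {ι₁ : L →+* ℂ} (V : HermSpace3 L ι₁),
      EmbBettiSide hHD hI h₁ (cmAbelianVarietyRealised_of_eigenbasis hHD hI h₃') V)
    (hR : DeligneMilne1982_Thm_6_20_full)
    (C : CdegS hHD hI h₁ (cmAbelianVarietyRealised_of_eigenbasis hHD hI h₃') h hA W μ) :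
    (picardCMUniverse hHD hI h₁ (cmAbelianVarietyRealised_of_eigenbasis hHD hI h₃')).PerL := by
  refine perL_picardCM_r18AE hHD hI h₁ h₃' hHR h hA (fun V c => (W V c).zeroSK) degS μ hBetti hR
    ?_ C ?_ ?_ ?_ ?_ ?_ ?_ ?_
  · -- `hsmall`
    intro L ι₁ V c hc hK i
    exact hsmall_degS hHD hI h₁ _ h (embOf hHD hI h₁ _) (coverOf hHD hI h₁ _ hA)
      (wmOfInput fun V c => (W V c).zeroSK) (d12Of μ) (d34Of μ) V c hc hK i
  · -- `hT`
    intro L ι₁ V c k N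
    exact isThetaArchContinuous_degS V c k N
  · -- `hpd`
    intro L ι₁ V c hV hc h6 k hk N hN
    exact ((isEmpty_C_fibre_degS hHD hI h₁ _ V c hV).false (C V c hV hc h6)).elim
  · -- `hk`
    intro L ι₁ V c hV hc h6 k hk N hN
    exact ((isEmpty_C_fibre_degS hHD hI h₁ _ V c hV).false (C V c hV hc h6)).elim
  · -- `gen12`
    intro L ι₁ V c
    exact gen12_degS' hHD hI h₁ _ h (embOf hHD hI h₁ _) (coverOf hHD hI h₁ _ hA)
      (fun V c => (W V c).zeroSK) μ V c
  · -- `real34`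
    intro L ι₁ V c _ _
    exact real34_zeroSK (embOf hHD hI h₁ _) (coverOf hHD hI h₁ _ hA) W _ h (d12Of μ) (d34Of μ) V c
  · -- `hyp12`
    intro L ι₁ V c _ _
    exact hyp12_zeroSK (embOf hHD hI h₁ _) (coverOf hHD hI h₁ _ hA) W _ h _ _ _ V c
  · -- `hyp34`
    intro L ι₁ V c _ _
    exact hyp34_zeroSK (embOf hHD hI h₁ _) (coverOf hHD hI h₁ _ hA) W _ h _ _ _ V c

/-- **E R18A closes from the degenerate data EXACTLY modulo the vacuity residual `NoGoodSextic`** (cf. SAN-15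
`perL_r10core_of_noGoodSextic`, SAN-17 `perL_r17Acore_of_noGoodSextic`; the residual is refuted by SAN-15b
`not_noGoodSextic`). -/
theorem perL_r18A_of_noGoodSextic (h₃ : CMAbelianVarietyRealised) (hHR : BettiUniverse.HodgeRiemann20) (h : Bool)
    (hA : Arapura2012_Cor_15_4_6)
    (W : ∀ {L : CMField} {ι₁ : L →+* ℂ} (V : HermSpace3 L ι₁) (c : SeesawCtx L), WmInput V c.D)
    (μ : ∀ {L : CMField}, SeesawCtx L → Fin 4 → NumberField.InfinitePlace L → ℤ)
    (hBetti : ∀ {L : CMField} {ι₁ : L →+* ℂ} (V : HermSpace3 L ι₁), EmbBettiSide hHD hI h₁ h₃ V)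
    (hR : DeligneMilne1982_Thm_6_20_full)
    (hno : NoGoodSextic hHD hI h₁ h₃ h hA W μ) :
    (picardCMUniverse hHD hI h₁ h₃).PerL :=
  perL_r18A_degS hHD hI h₁ h₃ hHR h hA W μ hBetti hR fun V c hV hc h6 => (hno V c hV hc h6).elim

end Sanity
end Model
end HodgeCM

end
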